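import Summits.NavierStokesRegularity.NavierStokesRegularity.Theorems.LerayQuarterDissipationFiniteDissipationLiouvilleSliceLSix
import Literature.Analysis.FluidPDE.BoundedMildWeakL3RieszPressure
import Literature.Analysis.FluidPDE.RieszPressureSpaceTimeLq
import Literature.Analysis.FluidPDE.SuitableWeakExhaustion
import Literature.Analysis.FluidPDE.SpaceTimeRescaling
import Mathlib.Analysis.SpecialFunctions.Integrability.Basic
import HarnessLib

/-!
# Route `CalmSliceGate`, crux `OneSymmetricSlice` (stmt-NavierStokesRegularity-24452):
# the RIESZ PRESSURE of a finite-dissipation Type-I ancient mild field, and the pair as a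
# distributional Navier–Stokes solution on `(−2, 0) × ℝ³`

Theorems file of route `CalmSliceGate` (seat ns-lqd-p2 g4, cell ns-idea-3; `--supports` the
crux; packaging brick 1/2 for the registered stub `stub_axisymTypeIExclusionStd`, which needs the
Seregin–Šverák barrier `AxisymmetricTypeIExclusion` — a statement about DISTRIBUTIONAL solutions
with a pressure in `L^{3/2}` of the unit cylinder). Navier–Stokes regularity is NOT proved here;
no summit is.

Let `w` be Type-I ancient mild (KNSS gauge, constant `C`) with the dissipation law
`∫‖∇w(s)‖² ≤ K/√(−s)`, and shift time, `u(τ, x) = w(τ − 2, x)`, `τ ∈ (0, 2)` (apex at `τ = 2`).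

* `lintegral_norm_slice_rpow_six_le` — the `L⁶` slices of the stratum
  (`Birth.memLp_six_slice`): `∫‖w(t)‖⁶ ≤ CL⁶ (K⁺)³ (−t)^{−3/2}`.
* `memLp_six_weighted` — the WEIGHTED space–time field
  `U(τ, x) = 1_{(0,2)}(τ) (2 − τ)^{1/8} u(τ, x)` lies in `L⁶(ℝ × ℝ³)`
  (`∫∫|U|⁶ ≤ c ∫₀² (2−τ)^{3/4 − 3/2} dτ < ∞`; the weight makes the apex integrable).
* `exists_weightedRieszPressure` — ONE call of the tree's space–time Riesz pressure
  (`RieszPressureLq.exists_spaceTime_rieszPressure`, `q = 3`) on `U` gives `Q ∈ L³(ℝ × ℝ³)` with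
  the slice-wise weak Poisson equation for `U`; `p(τ, x) = (2 − τ)^{−1/4} Q(τ, x)` then solves
  `∫ p(τ) Δφ = −∫ D²φ(u(τ), u(τ))` for a.e. `τ ∈ (0, 2)` (bilinearity), lies in `L³` of every window
  slab `(0, S) × ℝ³`, `S < 2`, and `u ∈ L⁶` there.
* `memLp_six_window`, `memLp_three_window` — `u ∈ L⁶` and `p ∈ L³` of every window slab
  `(0, S) × ℝ³`, `S < 2` (the weights are bounded there).
The sequel (`…OneSymmetricSliceDistributional`) turns `(u, p)` into a distributional solution on
the window slabs, glues along `S ↑ 2` and shifts back to `w`.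

References: KNSS, arXiv:0709.3599 §4; Lemarié-Rieusset 2016, Ch. 6 Prop. 6.5; Seregin–Šverák,
arXiv:0804.1803 §3 (the target barrier).
-/

noncomputable section

-- the summit and its single sub-problem share the name (CONVENTIONS §1), as in every Theorems file
set_option linter.dupNamespace false

namespace Summit.NavierStokesRegularity.NavierStokesRegularity.Theorems.OneSymmetricSlice.Birth

open MeasureTheory Set Filter Topology Metric Function TopologicalSpace
open Literature.Analysis Literature.Analysis.FluidPDE Literature.Analysis.UnboundedOperators
open scoped ENNReal NNReal RealInnerProductSpace Laplacian

/-! ### The `L⁶` slices of the stratum, as an `lintegral` bound -/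

/-- **`L⁶` slices of the stratum**: there is `A = A(K) ≥ 0` with
`∫ ‖w(t,x)‖⁶ dx ≤ A · (−t)^{−3/2}` (as an `lintegral`) for every member `w` of `𝒟_{C,K}` and every
`t < 0` (`Birth.memLp_six_slice`: `‖w(t)‖₆ ≤ CL √(K⁺/√(−t))`). [cite: KochNadirashviliSereginSverak2009, §4 (arXiv:0709.3599 p. 8)] -/
theorem exists_lintegral_norm_slice_six_le (K : ℝ) :
    ∃ A : ℝ, 0 ≤ A ∧ ∀ (C : ℝ) (w : ℝ → EuclideanSpace ℝ (Fin 3) → EuclideanSpace ℝ (Fin 3)),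
      IsTypeIAncientMild C w →
      (∀ s : ℝ, s < 0 → ∫⁻ x, ‖fderiv ℝ (w s) x‖ₑ ^ 2 ≤ ENNReal.ofReal (K / Real.sqrt (-s))) →
      ∀ t < 0, MemLp (w t) 6 volume ∧
        ∫⁻ x, ‖w t x‖ₑ ^ (6 : ℝ) ≤ ENNReal.ofReal (A * (-t) ^ (-(3 / 2 : ℝ))) := by
  obtain ⟨CL, hCL, hL⟩ := FiniteDissipationLiouville.Birth.memLp_six_slice
  refine ⟨CL ^ 6 * (max K 0) ^ 3, by positivity, fun C w hw hD t ht => ?_⟩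
  obtain ⟨hmem, hbd⟩ := hL C K w hw hD t ht
  refine ⟨hmem, ?_⟩
  have hmt : 0 < -t := neg_pos.2 ht
  have hsq : 0 < Real.sqrt (-t) := Real.sqrt_pos.2 hmt
  -- the real integral `∫‖w t‖⁶` and its bound
  have hI0 : 0 ≤ ∫ x, ‖w t x‖ ^ (6 : ℝ) := integral_nonneg fun x => by positivity
  have hroot : 0 ≤ CL * Real.sqrt (max K 0 / Real.sqrt (-t)) := by positivity
  have h6 : ∫ x, ‖w t x‖ ^ (6 : ℝ) ≤ (CL * Real.sqrt (max K 0 / Real.sqrt (-t))) ^ (6 : ℝ) := by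
    have h := Real.rpow_le_rpow (by positivity) hbd (by norm_num : (0 : ℝ) ≤ 6)
    rwa [← Real.rpow_mul hI0, show (1 / 6 : ℝ) * 6 = 1 by norm_num, Real.rpow_one] at h
  have hval : (CL * Real.sqrt (max K 0 / Real.sqrt (-t))) ^ (6 : ℝ) =
      CL ^ 6 * (max K 0) ^ 3 * (-t) ^ (-(3 / 2 : ℝ)) := by
    rw [show (6 : ℝ) = ((6 : ℕ) : ℝ) by norm_num, Real.rpow_natCast, mul_pow,
      show (6 : ℕ) = 2 * 3 by norm_num, pow_mul (Real.sqrt _), Real.sq_sqrt (by positivity),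
      div_pow]
    have e1 : Real.sqrt (-t) ^ 3 = (-t) ^ (3 / 2 : ℝ) := by
      rw [Real.sqrt_eq_rpow, ← Real.rpow_natCast, ← Real.rpow_mul hmt.le]; norm_num
    rw [e1, Real.rpow_neg hmt.le, div_eq_mul_inv]
    ring
  -- conversion to `lintegral`
  have hint : Integrable (fun x => ‖w t x‖ ^ (6 : ℝ)) volume := by
    have := hmem.integrable_norm_rpow (by norm_num) (by norm_num)
    simpa using this
  rw [← hval]
  calc ∫⁻ x, ‖w t x‖ₑ ^ (6 : ℝ)
      = ∫⁻ x, ENNReal.ofReal (‖w t x‖ ^ (6 : ℝ)) := by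
        refine lintegral_congr fun x => ?_
        rw [← ofReal_norm, ENNReal.ofReal_rpow_of_nonneg (norm_nonneg _) (by norm_num)]
    _ = ENNReal.ofReal (∫ x, ‖w t x‖ ^ (6 : ℝ)) :=
        (ofReal_integral_eq_lintegral_ofReal hint (Eventually.of_forall fun x => by positivity)).symm
    _ ≤ ENNReal.ofReal ((CL * Real.sqrt (max K 0 / Real.sqrt (-t))) ^ (6 : ℝ)) :=
        ENNReal.ofReal_le_ofReal h6


/-! ### The weighted space–time field and its Riesz pressure -/

/-- Integrability of the weight `(2 − τ)^{−3/4}` on `(0, 2)`. [folklore] -/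
theorem integrableOn_weight :
    IntegrableOn (fun τ : ℝ => (2 - τ) ^ (-(3 / 4 : ℝ))) (Ioo 0 2) volume := by
  have h := (intervalIntegral.intervalIntegrable_rpow' (a := 2) (b := 0) (by norm_num : (-1 : ℝ) < -(3 / 4))).comp_sub_left 2
  have h' : IntervalIntegrable (fun τ : ℝ => (2 - τ) ^ (-(3 / 4 : ℝ))) volume 0 2 := by
    simpa using h
  rw [intervalIntegrable_iff_integrableOn_Ioo_of_le (by norm_num)] at h'
  exact h'

/-- **The weighted field `U(τ,x) = 1_{(0,2)}(τ)(2−τ)^{1/8} w(τ−2, x)` is in `L⁶(ℝ × ℝ³)`** for a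
member `w` of `𝒟_{C,K}`: Tonelli and the slice bound `∫‖w(t)‖⁶ ≤ A(−t)^{−3/2}` give
`∫∫|U|⁶ ≤ A ∫₀² (2−τ)^{−3/4} dτ < ∞`. [cite: KochNadirashviliSereginSverak2009, §4 (arXiv:0709.3599 p. 8)] -/
theorem memLp_six_weighted {C K : ℝ}
    {w : ℝ → EuclideanSpace ℝ (Fin 3) → EuclideanSpace ℝ (Fin 3)} (hw : IsTypeIAncientMild C w)
    (hD : ∀ s : ℝ, s < 0 → ∫⁻ x, ‖fderiv ℝ (w s) x‖ₑ ^ 2 ≤ ENNReal.ofReal (K / Real.sqrt (-s))) :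
    MemLp ((Ioo (0 : ℝ) 2 ×ˢ (univ : Set (EuclideanSpace ℝ (Fin 3)))).indicator
      fun z : ℝ × EuclideanSpace ℝ (Fin 3) => ((2 - z.1) ^ (1 / 8 : ℝ)) • w (z.1 - 2) z.2) 6 volume := by
  obtain ⟨A, hA0, hA⟩ := exists_lintegral_norm_slice_six_le K
  have hO : MeasurableSet (Ioo (0 : ℝ) 2 ×ˢ (univ : Set (EuclideanSpace ℝ (Fin 3)))) :=
    measurableSet_Ioo.prod MeasurableSet.univ
  rw [memLp_indicator_iff_restrict hO]
  -- continuity of the weighted field on the open slab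
  have hcont : ContinuousOn (fun z : ℝ × EuclideanSpace ℝ (Fin 3) =>
      ((2 - z.1) ^ (1 / 8 : ℝ)) • w (z.1 - 2) z.2) (Ioo (0 : ℝ) 2 ×ˢ univ) := by
    have hf : ContinuousOn (fun z : ℝ × EuclideanSpace ℝ (Fin 3) => (2 - z.1) ^ (1 / 8 : ℝ))
        (Ioo (0 : ℝ) 2 ×ˢ univ) :=
      (continuous_const.sub continuous_fst).continuousOn.rpow_const fun z hz =>
        Or.inl (by have := (mem_prod.1 hz).1.2; dsimp; linarith)
    have hg : ContinuousOn (fun z : ℝ × EuclideanSpace ℝ (Fin 3) => w (z.1 - 2) z.2)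
        (Ioo (0 : ℝ) 2 ×ˢ univ) := by
      have e : (fun z : ℝ × EuclideanSpace ℝ (Fin 3) => w (z.1 - 2) z.2) =
          uncurry w ∘ fun z => (z.1 - 2, z.2) := rfl
      rw [e]
      refine hw.continuousOn_uncurry.comp (by fun_prop) fun z hz => ?_
      exact ⟨by have := (mem_prod.1 hz).1.2; simp only [mem_Iio]; linarith, mem_univ _⟩
    exact hf.smul hg
  refine ⟨hcont.aestronglyMeasurable hO, ?_⟩
  -- the `L⁶` norm through Tonelli
  rw [eLpNorm_lt_top_iff_lintegral_rpow_enorm_lt_top (by norm_num) (by norm_num)]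
  simp only [ENNReal.toReal_ofNat]
  rw [volume_restrict_prod_univ_eq_prod]
  refine (lintegral_prod_le _).trans_lt ?_
  -- slice by slice
  have hslice : ∀ τ ∈ Ioo (0 : ℝ) 2,
      ∫⁻ x, ‖((2 - τ) ^ (1 / 8 : ℝ)) • w (τ - 2) x‖ₑ ^ (6 : ℝ) ≤
        ENNReal.ofReal (A * (2 - τ) ^ (-(3 / 4 : ℝ))) := by
    intro τ hτ
    have h2 : 0 < 2 - τ := by linarith [hτ.2]
    have hwt := (hA C w hw hD (τ - 2) (by linarith [hτ.2])).2
    rw [show -(τ - 2) = 2 - τ by ring] at hwt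
    have e : ∀ x, ‖((2 - τ) ^ (1 / 8 : ℝ)) • w (τ - 2) x‖ₑ ^ (6 : ℝ) =
        ENNReal.ofReal ((2 - τ) ^ (3 / 4 : ℝ)) * ‖w (τ - 2) x‖ₑ ^ (6 : ℝ) := by
      intro x
      rw [enorm_smul, ENNReal.mul_rpow_of_nonneg _ _ (by norm_num), Real.enorm_eq_ofReal
        (Real.rpow_nonneg h2.le _), ENNReal.ofReal_rpow_of_nonneg (Real.rpow_nonneg h2.le _)
        (by norm_num), ← Real.rpow_mul h2.le]
      norm_num
    simp_rw [e]
    rw [lintegral_const_mul' _ _ ENNReal.ofReal_ne_top]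
    calc ENNReal.ofReal ((2 - τ) ^ (3 / 4 : ℝ)) * ∫⁻ x, ‖w (τ - 2) x‖ₑ ^ (6 : ℝ)
        ≤ ENNReal.ofReal ((2 - τ) ^ (3 / 4 : ℝ)) * ENNReal.ofReal (A * (2 - τ) ^ (-(3 / 2 : ℝ))) := by
          gcongr
      _ = ENNReal.ofReal (A * (2 - τ) ^ (-(3 / 4 : ℝ))) := by
          rw [← ENNReal.ofReal_mul (Real.rpow_nonneg h2.le _)]
          congr 1
          rw [mul_left_comm, ← Real.rpow_add h2]
          norm_num
  refine lt_of_le_of_lt (setLIntegral_mono' measurableSet_Ioo fun τ hτ => ?_)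
    ((integrableOn_weight.const_mul A).lintegral_lt_top)
  exact hslice τ hτ

/-- **The weighted Riesz pressure.** For a member `w` of `𝒟_{C,K}` there is a function
`Q ∈ L³(ℝ × ℝ³)` such that `p(τ, x) = (2 − τ)^{−1/4} Q(τ, x)` solves, for a.e. `τ ∈ (0, 2)`, the
weak pressure Poisson equation of the shifted field `u(τ) = w(τ − 2)`:
`∫ p(τ) Δφ = −∫ D²φ(u(τ), u(τ))` for all smooth compactly supported `φ` — ONE application of the
tree's space–time Riesz pressure (`q = 3`) to the weighted field `U = (2−τ)^{1/8} u`, followed by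
bilinearity. [cite: LemarieRieusset2016, Prop. 6.5 / Def. 6.9 (p. 136)] -/
theorem exists_weightedRieszPressure {C K : ℝ}
    {w : ℝ → EuclideanSpace ℝ (Fin 3) → EuclideanSpace ℝ (Fin 3)} (hw : IsTypeIAncientMild C w)
    (hD : ∀ s : ℝ, s < 0 → ∫⁻ x, ‖fderiv ℝ (w s) x‖ₑ ^ 2 ≤ ENNReal.ofReal (K / Real.sqrt (-s))) :
    ∃ Q : ℝ × EuclideanSpace ℝ (Fin 3) → ℝ, MemLp Q 3 volume ∧
      ∀ᵐ τ ∂(volume.restrict (Ioo (0 : ℝ) 2)),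
        ∀ φ : EuclideanSpace ℝ (Fin 3) → ℝ, ContDiff ℝ (⊤ : ℕ∞) φ → HasCompactSupport φ →
          ∫ x, ((2 - τ) ^ (-(1 / 4 : ℝ)) * Q (τ, x)) * (Δ φ) x =
            -∫ x, fderiv ℝ (fderiv ℝ φ) x (w (τ - 2) x) (w (τ - 2) x) := by
  set U : ℝ × EuclideanSpace ℝ (Fin 3) → EuclideanSpace ℝ (Fin 3) :=
    (Ioo (0 : ℝ) 2 ×ˢ (univ : Set (EuclideanSpace ℝ (Fin 3)))).indicator
      fun z => ((2 - z.1) ^ (1 / 8 : ℝ)) • w (z.1 - 2) z.2 with hU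
  have hU6 : MemLp U 6 volume := memLp_six_weighted hw hD
  obtain ⟨C₃, hC₃⟩ := RieszPressureLq.exists_spaceTime_rieszPressure (q := 3) (by norm_num)
  have e3 : ENNReal.ofReal (3 : ℝ) = 3 := ENNReal.ofReal_ofNat 3
  have e6 : ENNReal.ofReal (3 : ℝ) * 2 = 6 := by rw [e3]; norm_num
  obtain ⟨Q, hQ3, -, hQsl⟩ := hC₃ U (by rwa [e6])
  rw [e3] at hQ3
  refine ⟨Q, hQ3, ?_⟩
  filter_upwards [ae_restrict_of_ae hQsl, ae_restrict_mem measurableSet_Ioo] with τ hτ hτI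
  intro φ hφ hφc
  have h2 : 0 < 2 - τ := by linarith [hτI.2]
  have hUτ : ∀ y, U (τ, y) = ((2 - τ) ^ (1 / 8 : ℝ)) • w (τ - 2) y := fun y => by
    rw [hU, indicator_of_mem (show ((τ, y) : ℝ × EuclideanSpace ℝ (Fin 3)) ∈
      Ioo (0 : ℝ) 2 ×ˢ univ from ⟨hτI, mem_univ _⟩)]
  have key := hτ.2.2 φ hφ hφc
  -- `∫ Q Δφ = -(2-τ)^{1/4} ∫ D²φ(w, w)` (bilinearity)
  have hsq : ∀ x, fderiv ℝ (fderiv ℝ φ) x (U (τ, x)) (U (τ, x)) =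
      (2 - τ) ^ (1 / 4 : ℝ) * fderiv ℝ (fderiv ℝ φ) x (w (τ - 2) x) (w (τ - 2) x) := by
    intro x
    rw [hUτ, map_smul, map_smul]
    change (2 - τ) ^ (1 / 8 : ℝ) • ((2 - τ) ^ (1 / 8 : ℝ) •
      fderiv ℝ (fderiv ℝ φ) x (w (τ - 2) x) (w (τ - 2) x)) = _
    rw [smul_eq_mul, smul_eq_mul, ← mul_assoc, ← Real.rpow_add h2]
    norm_num
  simp_rw [hsq] at key
  rw [integral_const_mul] at key
  simp_rw [mul_assoc]
  rw [integral_const_mul, key, ← mul_neg, ← mul_assoc, ← Real.rpow_add h2]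
  norm_num

/-! ### Integrability of the pair on the window slabs -/

/-- **`u ∈ L⁶` of every window slab `(0, S) × ℝ³`, `S < 2`** (`|u| = (2−τ)^{−1/8}|U| ≤ (2−S)^{−1/8}|U|`
there). [cite: KochNadirashviliSereginSverak2009, §4 (arXiv:0709.3599 p. 8)] -/
theorem memLp_six_window {C K : ℝ}
    {w : ℝ → EuclideanSpace ℝ (Fin 3) → EuclideanSpace ℝ (Fin 3)} (hw : IsTypeIAncientMild C w)
    (hD : ∀ s : ℝ, s < 0 → ∫⁻ x, ‖fderiv ℝ (w s) x‖ₑ ^ 2 ≤ ENNReal.ofReal (K / Real.sqrt (-s)))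
    {S : ℝ} (hS2 : S < 2) :
    MemLp (uncurry fun τ x => w (τ - 2) x) 6
      (volume.restrict (Ioo (0 : ℝ) S ×ˢ (univ : Set (EuclideanSpace ℝ (Fin 3))))) := by
  have hU := (memLp_six_weighted hw hD).restrict (Ioo (0 : ℝ) S ×ˢ (univ : Set (EuclideanSpace ℝ (Fin 3))))
  have hO : MeasurableSet (Ioo (0 : ℝ) S ×ˢ (univ : Set (EuclideanSpace ℝ (Fin 3)))) :=
    measurableSet_Ioo.prod MeasurableSet.univ
  have hmeas : AEStronglyMeasurable (uncurry fun τ x => w (τ - 2) x)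
      (volume.restrict (Ioo (0 : ℝ) S ×ˢ (univ : Set (EuclideanSpace ℝ (Fin 3))))) := by
    have e : (uncurry fun τ x => w (τ - 2) x) =
        uncurry w ∘ fun z : ℝ × EuclideanSpace ℝ (Fin 3) => (z.1 - 2, z.2) := rfl
    rw [e]
    refine (hw.continuousOn_uncurry.comp (by fun_prop) fun z hz => ?_).aestronglyMeasurable hO
    exact ⟨by have := (mem_prod.1 hz).1.2; simp only [mem_Iio]; linarith, mem_univ _⟩
  have h2S : 0 < 2 - S := by linarith
  refine MemLp.of_le_mul (c := (2 - S) ^ (-(1 / 8 : ℝ))) hU hmeas ?_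
  filter_upwards [ae_restrict_mem hO] with z hz
  have hz2 : 0 < 2 - z.1 := by have := (mem_prod.1 hz).1.2; linarith
  rw [indicator_of_mem (show z ∈ Ioo (0 : ℝ) 2 ×ˢ univ from
    ⟨⟨(mem_prod.1 hz).1.1, by linarith [(mem_prod.1 hz).1.2]⟩, mem_univ _⟩), norm_smul,
    Real.norm_of_nonneg (Real.rpow_nonneg hz2.le _), ← mul_assoc]
  have hle : (1 : ℝ) ≤ (2 - S) ^ (-(1 / 8 : ℝ)) * (2 - z.1) ^ (1 / 8 : ℝ) := by
    have h1 : (2 - z.1) ^ (-(1 / 8 : ℝ)) ≤ (2 - S) ^ (-(1 / 8 : ℝ)) :=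
      Real.rpow_le_rpow_of_nonpos h2S (by linarith [(mem_prod.1 hz).1.2]) (by norm_num)
    calc (1 : ℝ) = (2 - z.1) ^ (-(1 / 8 : ℝ)) * (2 - z.1) ^ (1 / 8 : ℝ) := by
          rw [← Real.rpow_add hz2]; norm_num
      _ ≤ (2 - S) ^ (-(1 / 8 : ℝ)) * (2 - z.1) ^ (1 / 8 : ℝ) :=
          mul_le_mul_of_nonneg_right h1 (Real.rpow_nonneg hz2.le _)
  calc ‖uncurry (fun τ x => w (τ - 2) x) z‖ = 1 * ‖w (z.1 - 2) z.2‖ := by simp [uncurry]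
    _ ≤ (2 - S) ^ (-(1 / 8 : ℝ)) * (2 - z.1) ^ (1 / 8 : ℝ) * ‖w (z.1 - 2) z.2‖ :=
        mul_le_mul_of_nonneg_right hle (norm_nonneg _)

/-- **The weighted pressure is in `L³` of every window slab `(0, S) × ℝ³`, `S < 2`**
(`(2−τ)^{−1/4} ≤ (2−S)^{−1/4}` there). [cite: LemarieRieusset2016, Prop. 6.5 / Def. 6.9 (p. 136)] -/
theorem memLp_three_window {Q : ℝ × EuclideanSpace ℝ (Fin 3) → ℝ} (hQ : MemLp Q 3 volume)
    {S : ℝ} (hS2 : S < 2) :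
    MemLp (uncurry fun τ x => (2 - τ) ^ (-(1 / 4 : ℝ)) * Q (τ, x)) 3
      (volume.restrict (Ioo (0 : ℝ) S ×ˢ (univ : Set (EuclideanSpace ℝ (Fin 3))))) := by
  have hO : MeasurableSet (Ioo (0 : ℝ) S ×ˢ (univ : Set (EuclideanSpace ℝ (Fin 3)))) :=
    measurableSet_Ioo.prod MeasurableSet.univ
  have hQr := hQ.restrict (Ioo (0 : ℝ) S ×ˢ (univ : Set (EuclideanSpace ℝ (Fin 3))))
  have h2S : 0 < 2 - S := by linarith
  have hmeas : AEStronglyMeasurable (uncurry fun τ x => (2 - τ) ^ (-(1 / 4 : ℝ)) * Q (τ, x))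
      (volume.restrict (Ioo (0 : ℝ) S ×ˢ (univ : Set (EuclideanSpace ℝ (Fin 3))))) := by
    have e : (uncurry fun τ x => (2 - τ) ^ (-(1 / 4 : ℝ)) * Q (τ, x)) =
        fun z : ℝ × EuclideanSpace ℝ (Fin 3) => (2 - z.1) ^ (-(1 / 4 : ℝ)) * Q z := by
      funext ⟨τ, x⟩; rfl
    rw [e]
    refine AEStronglyMeasurable.mul ?_ hQr.1
    refine (ContinuousOn.aestronglyMeasurable ?_ hO)
    exact (continuous_const.sub continuous_fst).continuousOn.rpow_const fun z hz =>
      Or.inl (by have := (mem_prod.1 hz).1.2; dsimp; linarith)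
  refine MemLp.of_le_mul (c := (2 - S) ^ (-(1 / 4 : ℝ))) hQr hmeas ?_
  filter_upwards [ae_restrict_mem hO] with z hz
  have hz2 : 0 < 2 - z.1 := by have := (mem_prod.1 hz).1.2; linarith
  have h1 : (2 - z.1) ^ (-(1 / 4 : ℝ)) ≤ (2 - S) ^ (-(1 / 4 : ℝ)) :=
    Real.rpow_le_rpow_of_nonpos h2S (by linarith [(mem_prod.1 hz).1.2]) (by norm_num)
  calc ‖uncurry (fun τ x => (2 - τ) ^ (-(1 / 4 : ℝ)) * Q (τ, x)) z‖
      = (2 - z.1) ^ (-(1 / 4 : ℝ)) * ‖Q z‖ := by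
        rcases z with ⟨τ, x⟩
        simp only [uncurry, norm_mul, Real.norm_of_nonneg (Real.rpow_nonneg hz2.le _)]
    _ ≤ (2 - S) ^ (-(1 / 4 : ℝ)) * ‖Q z‖ := mul_le_mul_of_nonneg_right h1 (norm_nonneg _)

end Summit.NavierStokesRegularity.NavierStokesRegularity.Theorems.OneSymmetricSlice.Birth

end
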